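import Summits.CriticalPhenomena.Ising3DConformalLimit.Theses.TauBallRounding
import Literature.Probability.LatticeModels.DirInvCorrLength

/-!
# `RateExistsPositive` — the directional rate of the subcritical two-point function exists and is positive

Route `route-CriticalPhenomena-TauBallRounding`, item `stmt-CriticalPhenomena-4810` (support:
non-vacuity of T1/T2).

The item asks for a function `τ : ℝ → ℤ³ → ℝ` such that for all `0 < β < β_c(3)` and all `x ∈ ℤ³`
the sequence `-n⁻¹ log ⟨σ₀σ_{nx}⟩⁺_β` converges to `τ β x`, and `τ β x > 0` whenever `x ≠ 0`.

The witness is the directional inverse correlation length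
`Literature.Probability.LatticeModels.dirInvCorrLength 3` of `DirInvCorrLength.lean`:

* existence of the limit is Fekete's lemma on the subadditive sequence `-log ⟨σ₀σ_{nx}⟩⁺_β`
  (GKS II supermultiplicativity `twoPointPlus_mul_le_twoPointPlus` and positivity
  `⟨σ₀σ_y⟩⁺_β > 0` for `β > 0`), packaged there as `tendsto_dirInvCorrLength`
  (Campanino–Ioffe–Velenik 2003, §1.1, eq. (1.1));
* positivity for `0 < β < β_c(3)`, `x ≠ 0` is `dirInvCorrLength_pos`, i.e. the
  Aizenman–Barsky–Fernández sharpness theorem (`twoPoint_exponentialDecay_of_lt_criticalBeta_holds`)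
  together with `⟨·⟩⁺_β = ⟨·⟩^∅_β` below `β_c` (Campanino–Ioffe–Velenik 2003, Thm. 1.1).

No new mathematics is introduced here; the file only assembles the two Literature theorems into
the route's inlined signature.
-/

namespace Summit.CriticalPhenomena.Ising3DConformalLimit.Theorems

open Summit.CriticalPhenomena.Ising3DConformalLimit.Theses.TauBallRounding
open Literature.Probability.LatticeModels

/-- **Support item `stmt-CriticalPhenomena-4810` (`RateExistsPositive`).** There is a directional
rate function `τ : ℝ → Site 3 → ℝ` — namely the directional inverse correlation length
`dirInvCorrLength 3` — with `-n⁻¹ log ⟨σ₀σ_{nx}⟩⁺_β → τ β x` for every `0 < β < β_c(3)` and every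
`x ∈ ℤ³` (Fekete's lemma from GKS II, `tendsto_dirInvCorrLength`), and `τ β x > 0` for `x ≠ 0`
(Aizenman–Barsky–Fernández sharpness, `dirInvCorrLength_pos`). -/
theorem rateExistsPositive_proof :
    Summit.CriticalPhenomena.Ising3DConformalLimit.Theses.TauBallRounding.RateExistsPositive := by
  unfold RateExistsPositive
  refine ⟨fun β x => dirInvCorrLength 3 β x, fun β x hβ _ => tendsto_dirInvCorrLength hβ x,
    fun β x hβ hβc hx => ?_⟩
  exact dirInvCorrLength_pos (d := 3) (by norm_num) hβ hβc hx

end Summit.CriticalPhenomena.Ising3DConformalLimit.Theorems
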